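import Summits.ResolutionOfSingularities.ResolutionOfSingularities.Theorems.FrobeniusLadderFInjectiveMacaulayficationTrFull
import HarnessLib

/-!
# THE «FULL ⇒ REGULAR» FIBRE-LOCAL STEP `LocalRegularizationFibreFullTr p e r` (T″): the T-stub in the F-half's own shape, and why it closes
# (crux `FInjectiveMacaulayfication` stmt-ResolutionOfSingularities-15315, chain w45a; object O8 of res-L1-w45a-stub-3 g9 over `TrFull` p616255 / `ResolutionOfTr` p615457;
# answers res-L1-w45a-tri-2's caution (c1) of 08:06:38Z: demanding FULL stalks on S′ does NOT re-open a loop)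

[OURS · L1 W4.5a] Support file (`--supports stmt-ResolutionOfSingularities-15315 --as helper`); replaces the role of NO printed item; NOT a statement of any
manuscript; ONE definition (`@[conjecture] def LocalRegularizationFibreFullTr`, OURS candidate, consumed only as a hypothesis; no instance, no notation, no named
fact) and theorems CONDITIONAL on four published theorems BY NAME and on the chain's CANDIDATE statements. AI-written (AI review is weaker than expert review).

HONEST CORRECTION (of this seat's own v40 slogan). In `TrFull.ClosedPointLocalResolutionFullTr` (T_FULL) only the BASE germ `𝒪_{Y,y}` is FULL — the admissible modification
`S′` quantified over is in general NOT FULL. The letter in which «after the F-half the resolution side never sees a non-FULL germ» is LITERALLY true is the mirror image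
of the F-half `LocalFInjectivizationFibreAdmGe4` (binder for binder: `CMCl` on `S′` ↦ `FullCl`, `FullCl` in the conclusion ↦ regular, plus `FullCl` on the base germ):
* §1 `LocalRegularizationFibreFullTr p e r` (T″): at a CLOSED SINGULAR point `y` with FULL local ring of an integral separated finite-type `e`-fold over `k(X₁,…,X_r)`, every
  blowing up `S′ → Spec 𝒪_{Y,y}` along an ADMISSIBLE `I ≠ ⊥`, regular off the closed fibre and FULL AT EVERY STALK, admits a fibre-supported `𝓚 ≠ ⊥` ALL OF WHOSE
  BLOWINGS UP ARE REGULAR. `tStep_of_trFull : T_FULL → T″` (a desingularization's centre lies in `Sing S′ ⊆` the closed fibre); `tStep_mono` (res-L1-w45a-lead-1's tower iso).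
* §2 ★ `exists_regularCentre_of_cmCentre_of_fullCentre_of_tStep_at` — the POINTWISE TRIPLE COMPOSITION at one closed singular point: Česnavičius-(B) CM-centre → F-half
  FULL-centre → T″ regular centre = ONE fibre-supported centre of `S′` all of whose blowings up are regular (`exists_fullCentre_of_cmHalf_of_fHalf_at` + one layer:
  Stacks 080B twice, `IsBlowup.unique` once). ONE pass, NO alternation.
* §3 ★ `admitsDesingularization_of_regularOffFinite_of_localCentre` — the closed-point finishing engine of `ResolutionOfTr` with the local input handed over as a
  FIBRE-SUPPORTED centre with regular blowings up (fibre support is all Temkin's extension step consumes; Sing-support of the LOCAL centre is never used).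
* §4 ★★ `resolutionFullTr_of_cm_of_F_of_tStep (h4 : 4 ≤ e) (hG h081R hP) (hCM) (hRlt : T(p,e′,r′), 4 ≤ e′ < e, r′ ≥ 1) (hFe : F(e)) (hT : T″ p e r) : ResolutionFullTr p e r` —
  Temkin's induction on the FULL `Y`: non-closed points by the LOWER T-levels (`DimSlice.regularOffFinite_of_rungs`), closed points by §2 + §3.
* §5 ★★ strong induction on the level `resolutionFullTr_le_of_prints_of_F_of_tStep` (the lower T-levels come back through the square:
  `TrOfResolutionFull.tr_le_of_cesnaviciusOffClosed_of_F_of_resolutionFull`) and the door terms ★★★ `fInjectiveMacaulayfication_of_prints_of_LFadmF_of_tStep{,One}`: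
  **crux ⟸ four prints ∧ [CM ⇒ FULL fibre-local step `LocalFInjectivizationFibreAdmGe4`] ∧ [FULL ⇒ REGULAR fibre-local step `LocalRegularizationFibreFullTr p e 1`, e ≥ 4]**.
LETTER ORDER (R18.7 criterion): T″ ⟸ T_FULL (`tStep_of_trFull`) ⟸ T (`TrFull.trFull_of_tr`); conversely T″ ⇒ ResolutionFullTr ⇒ T given the prints, Česnavičius (B) and the
F-half (§5 + p613542) — all equivalent modulo prints ∧ F-half; T″ is the weakest letter so far. HONEST CAVEATS: open for every e ≥ 4; FULL ⊋ F-rational (not rung 15317);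
whether a v41 «FULL-TO-REGULAR DOOR» is registered is res-L1-w45a-plan-1's call — this file only supplies the kernel facts.
[folklore assembly; cite: Temkin2008, §2.1, Lemma 2.1.1, Lemma 2.1.4, Def. 2.2.6, Prop. 2.3.4] [cite: StacksProject, Tag 080B; Tag 085U; Tag 01J7] [cite: CossartPiltant2019, Thm. 1.1 (i)(ii); Prop. 4.4]
[cite: Cesnavicius2021, Thm. 5.3] [cite: RaynaudGruson1971, Thm. 5.2.2]
-/

-- single-problem summit: the doubled namespace component is forced
set_option linter.dupNamespace false

noncomputable section

namespace Summit.ResolutionOfSingularities.ResolutionOfSingularities.Theorems.FInjectiveMacaulayfication.TrFullStep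

open CategoryTheory CategoryTheory.Limits AlgebraicGeometry TopologicalSpace IsLocalRing Order
open Literature.AlgebraicGeometry.Resolution
open Summit.ResolutionOfSingularities.ResolutionOfSingularities.Theorems.FInjectiveMacaulayfication
open SliceableCentre ClosedPointLocalResolutionAdmTr TrOfResolution TrOfResolutionFull ResolutionOfTr TrFull FTemkinClosedPoints

/-! ## §1 The «FULL ⇒ REGULAR» fibre-local step -/

/-- [OURS · CANDIDATE statement] **`LocalRegularizationFibreFullTr p e r` (T″) — THE «FULL ⇒ REGULAR» FIBRE-LOCAL STEP at level `e` over `k(X₁,…,X_r)`**, the mirror image of the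
F-half `LocalFInjectivizationFibreAdmGe4`: for every field `k` of characteristic `p`, `K := FractionRing (MvPolynomial (Fin r) k)`, every integral separated finite-type `e`-fold
`Y/K`, every CLOSED point `y ∉ Reg Y` whose local ring is FULL (`SliceableCentre.FullCl p`), every blowing up `S′ → Spec 𝒪_{Y,y}` along an ADMISSIBLE centre `I ≠ ⊥`
(`supp I ⊆ (Reg Spec 𝒪_{Y,y})ᶜ`) which is regular off the closed fibre and FULL AT EVERY STALK admits `𝓚 ≠ ⊥` supported in the closed fibre ALL of whose blowings up are
REGULAR. Consumed only as a hypothesis. [candidate statement, OURS; cite: Temkin2008, Prop. 2.3.4 (iii); Def. 2.2.6] -/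
@[conjecture] def LocalRegularizationFibreFullTr (p e r : ℕ) : Prop :=
  ∀ (k : Type) [Field k] [CharP k p] (Y : Scheme.{0}) (g : Y ⟶ Spec (.of (FractionRing (MvPolynomial (Fin r) k)))),
    IsSeparated g → LocallyOfFiniteType g → QuasiCompact g → IsIntegral Y → topologicalKrullDim Y = e →
    ∀ y : Y, IsClosed ({y} : Set Y) → y ∉ Scheme.regularLocus Y → FullCl p (Y.presheaf.stalk y) →
      ∀ (S' : Scheme.{0}) (g' : S' ⟶ Spec (Y.presheaf.stalk y)) (I : (Spec (Y.presheaf.stalk y)).IdealSheafData),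
        I ≠ ⊥ → ((I.support : Set _) ⊆ (Scheme.regularLocus (Spec (Y.presheaf.stalk y)))ᶜ) → IsBlowup g' I →
        (∀ s : S', g'.base s ≠ closedPoint (Y.presheaf.stalk y) → s ∈ Scheme.regularLocus S') →
        (∀ s : S', FullCl p (S'.presheaf.stalk s)) →
        ∃ 𝓚 : S'.IdealSheafData, 𝓚 ≠ ⊥ ∧ (∀ s ∈ (𝓚.support : Set S'), g'.base s = closedPoint (Y.presheaf.stalk y)) ∧
          ∀ (S'' : Scheme.{0}) (π : S'' ⟶ S'), IsBlowup π 𝓚 → Scheme.IsRegular S''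

/-- **T_FULL ⇒ T″** (so T ⇒ T″): a desingularization `S″ = Bl_𝓚 S′ → S′` has `𝓚 ≠ ⊥` (the generic point of the integral `S′` is regular), `Supp 𝓚 ⊆ Sing S′ ⊆` the closed fibre
(regular off the fibre), and every blowing up along `𝓚` is isomorphic to `S″` (`IsBlowup.unique`), hence regular. [folklore] -/
theorem tStep_of_trFull {p e r : ℕ} (h : ClosedPointLocalResolutionFullTr p e r) : LocalRegularizationFibreFullTr p e r := by
  intro k _ _ Y g hs hl hq hi hd y hy _ hyfull S' g' I hI hIadm hg' hreg _
  haveI : IsLocallyNoetherian Y := by haveI := hl; exact LocallyOfFiniteType.isLocallyNoetherian g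
  haveI : IsIntegral S' := hg'.isIntegral hI
  have hfib : ∀ s : S', s ∉ Scheme.regularLocus S' → g'.base s = closedPoint (Y.presheaf.stalk y) := by
    intro s hs
    by_contra hne
    exact hs (hreg s hne)
  obtain ⟨S'', ρ, hdes⟩ := h k Y g hs hl hq hi hd y hy hyfull S' g' I hg' hIadm hfib
  obtain ⟨𝓚, hρ, h𝓚s⟩ := hdes.exists_isBlowup
  refine ⟨𝓚, ?_, fun s hs => hfib s (h𝓚s hs), fun S₂ π hπ t => ?_⟩
  · intro h0
    have hgen : genericPoint S' ∈ (𝓚.support : Set S') := by rw [h0, Scheme.IdealSheafData.support_bot]; trivial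
    exact h𝓚s hgen (genericPoint_mem_regularLocus S')
  · obtain ⟨e, -, -⟩ := hπ.unique hρ
    exact (Scheme.mem_regularLocus t).mp ((mem_regularLocus_iff_of_flat_of_isPreimmersion e.hom t).mpr (hdes.isRegular _))

/-- **Transcendence monotonicity of T″** (res-L1-w45a-lead-1's tower isomorphism; every other binder lives on `Y`). [folklore] -/
theorem tStep_mono {p e j : ℕ} (h : LocalRegularizationFibreFullTr p e j) (r : ℕ) : LocalRegularizationFibreFullTr p e (j + r) := by
  intro k _ _ Y g hs hl hq hi hd y hy hys hyfull S' g' I hI hIadm hg' hreg hSfull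
  obtain ⟨φ⟩ := ClosedPointLocalResolutionAdmTrMono.nonempty_ringEquiv_fractionRing_tower k j r
  haveI := NonClosedPointChart.charP_fractionRing_mvPolynomial p k r
  let ι : Spec (.of (FractionRing (MvPolynomial (Fin (j + r)) k))) ⟶
      Spec (.of (FractionRing (MvPolynomial (Fin j) (FractionRing (MvPolynomial (Fin r) k))))) :=
    Spec.map φ.toCommRingCatIso.hom
  haveI : IsIso ι := inferInstance
  haveI := hs; haveI := hl; haveI := hq
  exact h (FractionRing (MvPolynomial (Fin r) k)) Y (g ≫ ι) inferInstance inferInstance inferInstance hi hd y hy hys hyfull S' g' I hI hIadm hg' hreg hSfull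

/-- `r = 1` carries T″ at all `r ≥ 1`. [folklore] -/
theorem forall_tStep_of_one {p e : ℕ} (h : LocalRegularizationFibreFullTr p e 1) : ∀ r : ℕ, 1 ≤ r → LocalRegularizationFibreFullTr p e r := by
  intro r hr
  obtain ⟨r₀, rfl⟩ := Nat.exists_eq_add_of_le hr
  exact tStep_mono h r₀

/-! ## §2 The pointwise triple composition: CM-centre → FULL-centre → regular centre -/

-- adapted from this seat's `FInjectiveMacaulayficationDimFourSlice.exists_fullCentre_of_cmHalf_of_fHalf_at` (p596538): same pattern, one layer more
set_option maxHeartbeats 800000 in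
-- three blow-up existence calls, two 080B composites, one uniqueness transport
/-- ★ **Pointwise FULL/REGULAR composition at one closed singular point.** At `x ∉ Reg X` of an integral variety `X/k`: if every admissible fibre-regular local blow-up
`S′ → Spec 𝒪_{X,x}` (along `I ≠ ⊥`) has a fibre-supported centre all of whose blowings up are FULL (the conclusion of `exists_fullCentre_of_cmHalf_of_fHalf_at`), and every
admissible fibre-regular FULL local blow-up has a fibre-supported centre all of whose blowings up are REGULAR (T″ at `x`), then every admissible fibre-regular local
blow-up at `x` has a fibre-supported `𝓚 ≠ ⊥` all of whose blowings up are regular. [folklore assembly; cite: StacksProject, Tag 080B; Tag 085U] -/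
theorem exists_regularCentre_of_fullCentre_of_tStep_at
    (p : ℕ) {k : Type} [Field k] {X : Scheme.{0}} (f : X ⟶ Spec (.of k)) [LocallyOfFiniteType f] [IsIntegral X]
    (x : X) (hxs : x ∉ Scheme.regularLocus X)
    (hFull : ∀ (S' : Scheme.{0}) (g : S' ⟶ Spec (X.presheaf.stalk x)) (I : (Spec (X.presheaf.stalk x)).IdealSheafData),
      I ≠ ⊥ → (I.support : Set (Spec (X.presheaf.stalk x))) ⊆ (Scheme.regularLocus (Spec (X.presheaf.stalk x)))ᶜ → IsBlowup g I →
      (∀ s : S', g.base s ≠ closedPoint (X.presheaf.stalk x) → s ∈ Scheme.regularLocus S') →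
      ∃ 𝓚 : S'.IdealSheafData, 𝓚 ≠ ⊥ ∧ (∀ s ∈ (𝓚.support : Set S'), g.base s = closedPoint (X.presheaf.stalk x)) ∧
        ∀ (S'' : Scheme.{0}) (π : S'' ⟶ S'), IsBlowup π 𝓚 → ∀ s : S'', FullCl p (S''.presheaf.stalk s))
    (hT : ∀ (S' : Scheme.{0}) (g : S' ⟶ Spec (X.presheaf.stalk x)) (I : (Spec (X.presheaf.stalk x)).IdealSheafData),
      I ≠ ⊥ → (I.support : Set (Spec (X.presheaf.stalk x))) ⊆ (Scheme.regularLocus (Spec (X.presheaf.stalk x)))ᶜ → IsBlowup g I →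
      (∀ s : S', g.base s ≠ closedPoint (X.presheaf.stalk x) → s ∈ Scheme.regularLocus S') →
      (∀ s : S', FullCl p (S'.presheaf.stalk s)) →
      ∃ 𝓚 : S'.IdealSheafData, 𝓚 ≠ ⊥ ∧ (∀ s ∈ (𝓚.support : Set S'), g.base s = closedPoint (X.presheaf.stalk x)) ∧
        ∀ (S'' : Scheme.{0}) (π : S'' ⟶ S'), IsBlowup π 𝓚 → Scheme.IsRegular S'')
    (S' : Scheme.{0}) (g : S' ⟶ Spec (X.presheaf.stalk x)) (I : (Spec (X.presheaf.stalk x)).IdealSheafData)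
    (hI : I ≠ ⊥) (hIadm : (I.support : Set (Spec (X.presheaf.stalk x))) ⊆ (Scheme.regularLocus (Spec (X.presheaf.stalk x)))ᶜ)
    (hg : IsBlowup g I) (hreg : ∀ s : S', g.base s ≠ closedPoint (X.presheaf.stalk x) → s ∈ Scheme.regularLocus S') :
    ∃ 𝓚 : S'.IdealSheafData, 𝓚 ≠ ⊥ ∧ (∀ s ∈ (𝓚.support : Set S'), g.base s = closedPoint (X.presheaf.stalk x)) ∧
      ∀ (S'' : Scheme.{0}) (π : S'' ⟶ S'), IsBlowup π 𝓚 → Scheme.IsRegular S'' := by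
  classical
  haveI : IsLocallyNoetherian X := LocallyOfFiniteType.isLocallyNoetherian f
  haveI : IsIntegral S' := hg.isIntegral hI
  haveI : IsProper g := hg.isProper
  haveI : IsLocallyNoetherian S' := LocallyOfFiniteType.isLocallyNoetherian g
  haveI : CompactSpace S' := QuasiCompact.compactSpace_of_compactSpace g
  haveI : IsNoetherian S' := {}
  -- Step 1: FULL-ify `S'` along a fibre-supported `𝓚₁`
  obtain ⟨𝓚₁, h𝓚₁ne, h𝓚₁fib, h𝓚₁full⟩ := hFull S' g I hI hIadm hg hreg
  obtain ⟨S₁, π₁, hπ₁⟩ := exists_isBlowup S' 𝓚₁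
  haveI : IsIntegral S₁ := hπ₁.isIntegral h𝓚₁ne
  haveI : IsProper π₁ := hπ₁.isProper
  haveI : IsLocallyNoetherian S₁ := LocallyOfFiniteType.isLocallyNoetherian π₁
  haveI : CompactSpace S₁ := QuasiCompact.compactSpace_of_compactSpace π₁
  haveI : IsNoetherian S₁ := {}
  -- `S₁ → Spec 𝒪_{X,x}` is again a blowing up along a non-zero ADMISSIBLE centre (080B; the closed point is singular since `x ∉ Reg X`)
  obtain ⟨I₁, hI₁, hI₁T⟩ := hg.exists_isBlowup_comp_supported g I π₁ 𝓚₁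
    ((I.support : Set (Spec (X.presheaf.stalk x))) ∪ {closedPoint (X.presheaf.stalk x)}) Set.subset_union_left hπ₁
    (fun s hs => Or.inr (h𝓚₁fib s hs))
  have hI₁ne : I₁ ≠ ⊥ := RegularBlowupModelDim2.ne_bot_of_isBlowup hI₁
  have hI₁adm : (I₁.support : Set (Spec (X.presheaf.stalk x))) ⊆ (Scheme.regularLocus (Spec (X.presheaf.stalk x)))ᶜ := by
    refine hI₁T.trans (Set.union_subset hIadm ?_)
    rintro _ rfl hreg0
    apply hxs
    haveI : Flat (X.fromSpecStalk x) := flat_fromSpecStalk X x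
    have := (mem_regularLocus_iff_of_flat_of_isPreimmersion (X.fromSpecStalk x) (closedPoint (X.presheaf.stalk x))).mp hreg0
    rwa [Scheme.fromSpecStalk_closedPoint] at this
  have hcomp : ∀ s : S₁, (π₁ ≫ g).base s = g.base (π₁.base s) := fun s => by
    rw [Scheme.Hom.comp_apply]
  -- `S₁` is regular off its closed fibre and FULL everywhere
  have hreg₁ : ∀ s : S₁, (π₁ ≫ g).base s ≠ closedPoint (X.presheaf.stalk x) → s ∈ Scheme.regularLocus S₁ := by
    intro s hs
    rw [hcomp] at hs
    have hs' : π₁.base s ∉ (𝓚₁.support : Set S') := fun h => hs (h𝓚₁fib _ h)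
    haveI := hπ₁.isIso_compl
    exact (mem_regularLocus_iff_of_isIso_morphismRestrict π₁ ⟨(𝓚₁.support : Set S')ᶜ, 𝓚₁.support.isClosed.isOpen_compl⟩ s hs').mpr
      (hreg _ hs)
  have hfull₁ : ∀ s : S₁, FullCl p (S₁.presheaf.stalk s) := fun s => h𝓚₁full S₁ π₁ hπ₁ s
  -- Step 2: regularize `S₁` along a fibre-supported `𝓚₂` (T″ at `x`)
  obtain ⟨𝓚₂, h𝓚₂ne, h𝓚₂fib, h𝓚₂reg⟩ := hT S₁ (π₁ ≫ g) I₁ hI₁ne hI₁adm hI₁ hreg₁ hfull₁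
  obtain ⟨S₂, π₂, hπ₂⟩ := exists_isBlowup S₁ 𝓚₂
  haveI : IsIntegral S₂ := hπ₂.isIntegral h𝓚₂ne
  -- Step 3: `S₂ → S₁ → S'` is ONE blowing up of `S'` along a fibre-supported `𝓚 ≠ ⊥` (080B)
  obtain ⟨𝓚, h𝓚, h𝓚T⟩ := hπ₁.exists_isBlowup_comp_supported π₁ 𝓚₁ π₂ 𝓚₂
    {s : S' | g.base s = closedPoint (X.presheaf.stalk x)} (fun s hs => h𝓚₁fib s hs) hπ₂
    (fun s hs => by
      have h := h𝓚₂fib s hs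
      rw [hcomp] at h
      exact h)
  have h𝓚ne : 𝓚 ≠ ⊥ := RegularBlowupModelDim2.ne_bot_of_isBlowup h𝓚
  refine ⟨𝓚, h𝓚ne, fun s hs => h𝓚T hs, fun S'' π hπ s => ?_⟩
  -- Step 4: uniqueness of blowing up + stalk transport of regularity
  obtain ⟨e, -, -⟩ := hπ.unique h𝓚
  exact (Scheme.mem_regularLocus s).mp ((mem_regularLocus_iff_of_flat_of_isPreimmersion e.hom s).mpr (h𝓚₂reg S₂ π₂ hπ₂ _))

/-! ## §3 The closed-point finishing engine, local input = a fibre-supported centre with regular blowings up -/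

-- adapted from this seat's `ResolutionOfTr.admitsDesingularization_of_regularOffFinite_of_localRes` (p615457): the local centre is handed over directly
set_option maxHeartbeats 1600000 in
-- long: one Temkin step (flat base change, local centre, extension, composite) inside a Finset induction
/-- ★ **THE CLOSED-POINT FINISHING ENGINE, fibre-supported-centre form.** `X/k` an integral variety; `f : X′ → X` a blowing up along `J` with `Supp J ⊆ Sing X`, regular off the
preimage of a finite set `F` of closed points; `hloc`: at every CLOSED SINGULAR `b`, every blowing up `S′ → Spec 𝒪_{X,b}` along an admissible `I ≠ ⊥` that is regular off the
closed fibre admits a FIBRE-SUPPORTED centre all of whose blowings up are regular. Then `X` admits a desingularization. Temkin's extension step consumes only the fibre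
support of the local centre (its extension to `X′` is supported over `b ∈ Sing X`). [folklore; cite: Temkin2008, Prop. 2.3.4, Lemma 2.1.1, Lemma 2.1.4] [cite: StacksProject, Tag 080B] -/
theorem admitsDesingularization_of_regularOffFinite_of_localCentre
    {k : Type} [Field k] (X : Scheme.{0}) (f₀ : X ⟶ Spec (.of k))
    [IsSeparated f₀] [LocallyOfFiniteType f₀] [QuasiCompact f₀] [IsIntegral X]
    (hloc : ∀ b : X, IsClosed ({b} : Set X) → b ∉ Scheme.regularLocus X →
      ∀ (S' : Scheme.{0}) (g : S' ⟶ Spec (X.presheaf.stalk b)) (I : (Spec (X.presheaf.stalk b)).IdealSheafData),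
      I ≠ ⊥ → ((I.support : Set (Spec (X.presheaf.stalk b))) ⊆ (Scheme.regularLocus (Spec (X.presheaf.stalk b)))ᶜ) → IsBlowup g I →
      (∀ s : S', g.base s ≠ closedPoint (X.presheaf.stalk b) → s ∈ Scheme.regularLocus S') →
      ∃ 𝓚 : S'.IdealSheafData, 𝓚 ≠ ⊥ ∧ (∀ s ∈ (𝓚.support : Set S'), g.base s = closedPoint (X.presheaf.stalk b)) ∧
        ∀ (S'' : Scheme.{0}) (π : S'' ⟶ S'), IsBlowup π 𝓚 → Scheme.IsRegular S'')
    (X' : Scheme.{0}) (f : X' ⟶ X) (J : X.IdealSheafData) (hf : IsBlowup f J)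
    (hJ : (J.support : Set X) ⊆ (Scheme.regularLocus X)ᶜ)
    (F : Finset X) (hFcl : ∀ b ∈ F, IsClosed ({b} : Set X)) (hreg : ∀ x' : X', f x' ∉ F → x' ∈ Scheme.regularLocus X') :
    Scheme.AdmitsDesingularization X := by
  classical
  haveI : IsLocallyNoetherian X := LocallyOfFiniteType.isLocallyNoetherian f₀
  haveI : CompactSpace X := QuasiCompact.compactSpace_of_compactSpace f₀
  haveI : IsNoetherian X := {}
  set T : Set X := (Scheme.regularLocus X)ᶜ with hT
  have hne_of_supp : ∀ J₁ : X.IdealSheafData, (J₁.support : Set X) ⊆ T → J₁ ≠ ⊥ := by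
    intro J₁ hJ₁ h0
    have hgen : genericPoint X ∈ (J₁.support : Set X) := by rw [h0, Scheme.IdealSheafData.support_bot]; trivial
    have := hJ₁ hgen
    rw [hT, Set.mem_compl_iff, Scheme.mem_regularLocus] at this
    exact this (inferInstanceAs (IsRegularLocalRing X.functionField))
  suffices H : ∀ U : Finset X, (∀ b ∈ U, IsClosed ({b} : Set X)) →
      ∀ (X' : Scheme.{0}) (f : X' ⟶ X) (J : X.IdealSheafData), IsBlowup f J → (J.support : Set X) ⊆ T →
        (∀ x' : X', ¬ IsClosed ({f x'} : Set X) → x' ∈ Scheme.regularLocus X') →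
        (∀ x' : X', f x' ∉ U → x' ∈ Scheme.regularLocus X') →
        ∃ (X'' : Scheme.{0}) (f'' : X'' ⟶ X) (J'' : X.IdealSheafData), IsBlowup f'' J'' ∧ J'' ≠ ⊥ ∧
          (J''.support : Set X) ⊆ (Scheme.regularLocus X)ᶜ ∧ Scheme.IsRegular X'' by
    obtain ⟨X'', f'', J'', hf'', -, hJ'', hreg''⟩ :=
      H F hFcl X' f J hf hJ (fun x' hx' => hreg x' fun h => hx' (hFcl _ h)) hreg
    exact ⟨X'', f'', ⟨J'', hf'', hJ''⟩, hreg''⟩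
  intro U
  induction U using Finset.induction with
  | empty =>
    intro _ X' f J hf hJ _ hregU
    exact ⟨X', f, J, hf, hne_of_supp J hJ, hJ, fun x' => (Scheme.mem_regularLocus x').mp (hregU x' (by simp))⟩
  | insert b U hbU ih =>
    intro hcl X' f J hf hJ hregnc hregU
    have hb : IsClosed ({b} : Set X) := hcl b (Finset.mem_insert_self b U)
    have hclU : ∀ b' ∈ U, IsClosed ({b'} : Set X) := fun b' hb' => hcl b' (Finset.mem_insert_of_mem hb')
    have hJne : J ≠ ⊥ := hne_of_supp J hJ
    haveI : IsProper f := hf.isProper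
    haveI : IsLocallyNoetherian X' := LocallyOfFiniteType.isLocallyNoetherian f
    haveI : CompactSpace X' := QuasiCompact.compactSpace_of_compactSpace f
    haveI : IsNoetherian X' := {}
    haveI : IsIntegral X' := hf.isIntegral hJne
    by_cases hbT : b ∉ T
    · refine ih hclU X' f J hf hJ hregnc fun x' hx' => ?_
      by_cases hxb : f x' = b
      · have h2 : f x' ∉ (J.support : Set X) := fun h => hbT (hJ (hxb ▸ h))
        haveI := hf.isIso_compl
        have h1 : f x' ∈ Scheme.regularLocus X := by
          rw [hxb]; by_contra h; exact hbT h
        exact (mem_regularLocus_iff_of_isIso_morphismRestrict f ⟨(J.support : Set X)ᶜ, J.support.isClosed.isOpen_compl⟩ x' h2).mpr h1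
      · exact hregU x' (by simp [hxb, hx'])
    push Not at hbT
    haveI : Flat (X.fromSpecStalk b) := flat_fromSpecStalk X b
    haveI : IsNoetherian (pullback f (X.fromSpecStalk b)) := {}
    have hgb : IsBlowup (pullback.snd f (X.fromSpecStalk b)) (J.comap (X.fromSpecStalk b)) :=
      hf.pullback_snd_of_flat (X.fromSpecStalk b)
    have hfj : ∀ s : ↑(pullback f (X.fromSpecStalk b)),
        f (pullback.fst f (X.fromSpecStalk b) s) = X.fromSpecStalk b (pullback.snd f (X.fromSpecStalk b) s) := fun s => by
      rw [← Scheme.Hom.comp_apply, pullback.condition, Scheme.Hom.comp_apply]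
    have hJb : J.comap (X.fromSpecStalk b) ≠ ⊥ := GermOfGlobalBlowup.comap_fromSpecStalk_ne_bot hJne b
    -- `S'` is regular off the closed fibre
    have hregS' : ∀ s : ↑(pullback f (X.fromSpecStalk b)),
        (pullback.snd f (X.fromSpecStalk b)).base s ≠ closedPoint (X.presheaf.stalk b) →
          s ∈ Scheme.regularLocus (pullback f (X.fromSpecStalk b)) := by
      intro s hs
      rw [mem_regularLocus_iff_pullback_fst_fromSpecStalk f b s]
      apply hregnc
      have hyb : f (pullback.fst f (X.fromSpecStalk b) s) ⤳ b := by
        have := Set.mem_range_self (f := pullback.fst f (X.fromSpecStalk b)) s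
        rw [range_pullback_fst_fromSpecStalk] at this
        exact this
      refine not_isClosed_of_specializes_of_ne hyb fun heq => hs ?_
      apply (X.fromSpecStalk b).isEmbedding.injective
      rw [← hfj s, heq, Scheme.fromSpecStalk_closedPoint]
    have hadm : ((J.comap (X.fromSpecStalk b)).support : Set ↑(Spec (X.presheaf.stalk b))) ⊆
        (Scheme.regularLocus (Spec (X.presheaf.stalk b)))ᶜ :=
      AdmissibleLocalCentre.support_comap_fromSpecStalk_subset J hJ b
    -- the local fibre-supported centre with regular blowings up
    obtain ⟨𝓚, -, h𝓚fib, h𝓚reg⟩ := hloc b hb hbT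
      (pullback f (X.fromSpecStalk b)) (pullback.snd f (X.fromSpecStalk b)) (J.comap (X.fromSpecStalk b)) hJb hadm hgb hregS'
    obtain ⟨J', hJ'𝓚, hJ'supp⟩ := exists_idealSheaf_extension_fromSpecStalk f b 𝓚
    obtain ⟨X'', f', hf'⟩ := exists_isBlowup X' J'
    have h𝓚b : ∀ s ∈ (𝓚.support : Set ↑(pullback f (X.fromSpecStalk b))), f (pullback.fst f (X.fromSpecStalk b) s) = b := by
      intro s hs
      rw [hfj s, h𝓚fib s hs, Scheme.fromSpecStalk_closedPoint]
    have hJ'b : f '' (J'.support : Set X') ⊆ {b} := by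
      rw [hJ'supp]
      refine (image_closure_subset_closure_image f.continuous).trans ?_
      refine hb.closure_subset_iff.mpr ?_
      rintro _ ⟨_, ⟨s, hs, rfl⟩, rfl⟩
      exact h𝓚b s hs
    have hJ'T : (J'.support : Set X') ⊆ f ⁻¹' T := fun x' hx' => by
      have : f x' = b := hJ'b ⟨x', hx', rfl⟩
      show f x' ∈ T
      rw [this]; exact hbT
    obtain ⟨J₂, hf₂, hJ₂⟩ := hf.exists_isBlowup_comp_supported f J f' J' T hJ hf' hJ'T
    haveI : IsProper f' := hf'.isProper
    refine ih hclU X'' (f' ≫ f) J₂ hf₂ hJ₂ (fun x'' hx'' => ?_) (fun x'' hx'' => ?_)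
    · rw [Scheme.Hom.comp_apply] at hx''
      have h2 : f' x'' ∉ (J'.support : Set X') := fun h => by
        have : f (f' x'') = b := hJ'b ⟨_, h, rfl⟩
        exact hx'' (this ▸ hb)
      haveI := hf'.isIso_compl
      exact (mem_regularLocus_iff_of_isIso_morphismRestrict f' ⟨(J'.support : Set X')ᶜ, J'.support.isClosed.isOpen_compl⟩ x'' h2).mpr (hregnc _ hx'')
    · rw [Scheme.Hom.comp_apply] at hx''
      by_cases hxb : f (f' x'') = b
      · have hs : f' x'' ∈ Set.range (pullback.fst f (X.fromSpecStalk b)) := mem_range_pullback_fst_fromSpecStalk_of_eq f b hxb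
        have hT'' : IsBlowup (pullback.snd f' (pullback.fst f (X.fromSpecStalk b))) 𝓚 := by
          rw [← hJ'𝓚]
          exact hf'.pullback_snd_of_flat _
        have hx''range : x'' ∈ Set.range (pullback.fst f' (pullback.fst f (X.fromSpecStalk b))) := by
          rw [Scheme.Pullback.range_fst]
          exact hs
        obtain ⟨t, rfl⟩ := hx''range
        exact (mem_regularLocus_iff_of_flat_of_isPreimmersion _ t).mp ((Scheme.mem_regularLocus t).mpr (h𝓚reg _ _ hT'' t))
      · have h2 : f' x'' ∉ (J'.support : Set X') := fun h => hxb (hJ'b ⟨_, h, rfl⟩)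
        haveI := hf'.isIso_compl
        have hx'U : f (f' x'') ∉ insert b U := by simp [hxb, hx'']
        exact (mem_regularLocus_iff_of_isIso_morphismRestrict f' ⟨(J'.support : Set X')ᶜ, J'.support.isClosed.isOpen_compl⟩ x'' h2).mpr
          (hregU (f' x'') (by simpa using hx'U))

end Summit.ResolutionOfSingularities.ResolutionOfSingularities.Theorems.FInjectiveMacaulayfication.TrFullStep

end
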